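import Literature.Probability.LatticeModels.KernelTreeDecay
import Mathlib.Data.NNReal.Defs
import Mathlib.Analysis.SpecialFunctions.Exp
import HarnessLib

/-!
# Submultiplicative tree weights on label sets (decay-weighted `L¹–L^∞` norms)

Topic `Literature/Probability/LatticeModels`; the weight bookkeeping of DECAY information in the
single-scale cluster / renormalisation-group estimates (Benfatto–Giuliani–Mastropietro 2006, §3 (3.2)–(3.8):
the position-space moments `∫ dx |x|ⁿ |β²_h(x)|` of the two-point kernels and of partially contracted
four-point kernels; Gentile–Mastropietro 2001, §4; Brydges 1986, §3 and Salmhofer 1998, §4.1: tree-length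
weighted norms).  In the tree-expansion bound of a truncated expectation the output fields sit at positions
belonging to the input vertices, and all the vertices are connected by the lines of the anchored tree; a weight
of the OUTPUT label set is therefore dominated by the product of the weights of the input vertices and of the
tree lines as soon as the weight is monotone and submultiplicative on overlapping unions.  This file isolates
that bookkeeping:

* `IsTreeWeight wt` — a weight `wt : Finset Λ → ℝ` on finite label sets with `1 ≤ wt`, monotone under
  inclusion and `wt (S ∪ T) ≤ wt S · wt T` whenever `S ∩ T ≠ ∅`; the constant weight `1`
  (`IsTreeWeight.const_one`), pull-backs along label maps (`IsTreeWeight.comap`, used for replica labels),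
  and the three-factor form `wt (S ∪ T) ≤ wt S · wt {a, b} · wt T` for `a ∈ S`, `b ∈ T` (a line joining
  `S` and `T`; `IsTreeWeight.union_le_of_mem`);
* `IsLabelDist d`, `labelDiam d S` — a pseudo-distance on labels (zero on the diagonal is NOT required to
  separate labels: internal indices are invisible) and the diameter of a label set; `labelDiam_pair`,
  `le_labelDiam`, `labelDiam_mono`, `labelDiam_union_le` (overlapping sets);
* `diamWeight φ d S = φ (labelDiam d S)` is a tree weight for every `φ ≥ 1` monotone and submultiplicative
  on `[0, ∞)` (`isTreeWeight_diamWeight`); the two standard choices `φ(s) = (1 + c s)^N`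
  (`isTreeWeight_polyDiamWeight`, with `(c · d(a,b))^j ≤ wt {a,b}` for `j ≤ N`, `pow_le_polyDiamWeight_pair`:
  the weighted pair norm dominates the moments up to order `N`) and `φ(s) = e^{c s}` (`isTreeWeight_expDiamWeight`);
* **`IsTreeWeight.wt_image_le_prod`** — the tree product bound: for a valid script `s` (an anchored tree on
  its points), slots `τ : S` of the points (`cS τ`) carrying labels `x τ`, and for every line `ℓ` of `s` a
  pair of slots `e ℓ` sitting at the two points of `ℓ`, the weight of the set of ALL labels of the points of
  `s` is at most `∏_{points u} wt (labels of u) · ∏_{lines ℓ} wt {x (e ℓ).1, x (e ℓ).2}`.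

Everything is proved; the definitions are the two predicates, the diameter and the diameter weights.
[folklore]

## Sources

G. Benfatto, A. Giuliani, V. Mastropietro, Ann. Henri Poincaré 7 (2006) 809–898, §3 (3.2)–(3.8)
(`BenfattoGiulianiMastropietro2006`); G. Gentile, V. Mastropietro, Phys. Rep. 352 (2001) 273–437, §4
(`GentileMastropietro2001`); D. C. Brydges, Les Houches 1984, §3 (`Brydges1986`); M. Salmhofer, Comm. Math.
Phys. 194 (1998) 249–295, §4.1 (`Salmhofer1998`).
-/

noncomputable section

open Finset

namespace Literature.Probability.LatticeModels

namespace BattleFederbush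

/-! ### Tree weights -/

section TreeWeight

variable {Λ : Type*} [DecidableEq Λ]

/-- A **tree weight** on finite label sets: at least `1`, monotone under inclusion, and submultiplicative on
overlapping unions. [folklore] -/
structure IsTreeWeight (wt : Finset Λ → ℝ) : Prop where
  /-- `1 ≤ wt S` -/
  one_le : ∀ S, 1 ≤ wt S
  /-- monotone under inclusion -/
  mono : ∀ ⦃S T : Finset Λ⦄, S ⊆ T → wt S ≤ wt T
  /-- submultiplicative on overlapping unions -/
  union_le : ∀ ⦃S T : Finset Λ⦄, (S ∩ T).Nonempty → wt (S ∪ T) ≤ wt S * wt T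

namespace IsTreeWeight

variable {wt : Finset Λ → ℝ}

/-- Tree weights are nonnegative. [folklore] -/
theorem nonneg (h : IsTreeWeight wt) (S : Finset Λ) : 0 ≤ wt S := zero_le_one.trans (h.one_le S)

/-- Tree weights are positive. [folklore] -/
theorem pos (h : IsTreeWeight wt) (S : Finset Λ) : 0 < wt S := zero_lt_one.trans_le (h.one_le S)

/-- The constant weight `1` is a tree weight (the unweighted norms). [folklore] -/
theorem const_one : IsTreeWeight (fun _ : Finset Λ => (1 : ℝ)) where
  one_le _ := le_rfl
  mono _ _ _ := le_rfl
  union_le _ _ _ := by rw [mul_one]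

/-- **A line joining two sets**: for `a ∈ S`, `b ∈ T`, `wt (S ∪ T) ≤ wt S · wt {a, b} · wt T`. [folklore] -/
theorem union_le_of_mem (h : IsTreeWeight wt) {S T : Finset Λ} {a b : Λ} (ha : a ∈ S) (hb : b ∈ T) :
    wt (S ∪ T) ≤ wt S * wt {a, b} * wt T := by
  have h1 : S ∪ T ⊆ (S ∪ {a, b}) ∪ T :=
    union_subset (subset_union_left.trans subset_union_left) subset_union_right
  have h2 : ((S ∪ {a, b}) ∩ T).Nonempty := ⟨b, mem_inter.2 ⟨mem_union_right _ (by simp), hb⟩⟩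
  have h3 : (S ∩ {a, b}).Nonempty := ⟨a, mem_inter.2 ⟨ha, by simp⟩⟩
  calc wt (S ∪ T) ≤ wt ((S ∪ {a, b}) ∪ T) := h.mono h1
    _ ≤ wt (S ∪ {a, b}) * wt T := h.union_le h2
    _ ≤ wt S * wt {a, b} * wt T := mul_le_mul_of_nonneg_right (h.union_le h3) (h.nonneg T)

/-- **Pull-back of a tree weight along a label map** (replica labels `(a, X) ↦ X`):
`S' ↦ wt (S'.image f)` is a tree weight. [folklore] -/
theorem comap {Λ' : Type*} [DecidableEq Λ'] (h : IsTreeWeight wt) (f : Λ' → Λ) :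
    IsTreeWeight (fun S' : Finset Λ' => wt (S'.image f)) where
  one_le S' := h.one_le _
  mono S' T' hST := h.mono (image_subset_image hST)
  union_le S' T' hST := by
    obtain ⟨c, hc⟩ := hST
    rw [image_union]
    exact h.union_le ⟨f c, mem_inter.2 ⟨mem_image_of_mem f (mem_inter.1 hc).1, mem_image_of_mem f (mem_inter.1 hc).2⟩⟩

/-- Products of tree weights over a finset are at least `1`. [folklore] -/
theorem one_le_prod {ι : Type*} (h : IsTreeWeight wt) (s : Finset ι) (F : ι → Finset Λ) :
    1 ≤ ∏ i ∈ s, wt (F i) := by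
  classical
  induction s using Finset.induction_on with
  | empty => simp
  | insert i s hi ih =>
    rw [prod_insert hi]
    exact one_le_mul_of_one_le_of_one_le (h.one_le _) ih

/-- Products of tree weights over a list are nonnegative. [folklore] -/
theorem prod_map_nonneg {ι : Type*} (h : IsTreeWeight wt) (l : List ι) (F : ι → Finset Λ) :
    0 ≤ (l.map fun i => wt (F i)).prod :=
  List.prod_nonneg fun r hr => by
    obtain ⟨i, -, rfl⟩ := List.mem_map.1 hr
    exact h.nonneg _

end IsTreeWeight

end TreeWeight

/-! ### Label pseudo-distances and diameters -/

section Diam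

variable {Λ : Type*}

/-- A **pseudo-distance on labels**: symmetric, nonnegative, zero on the diagonal and subadditive (distinct
labels may be at distance zero — internal indices are invisible). [folklore] -/
structure IsLabelDist (d : Λ → Λ → ℝ) : Prop where
  /-- `d a a = 0` -/
  self : ∀ a, d a a = 0
  /-- symmetry -/
  symm : ∀ a b, d a b = d b a
  /-- nonnegativity -/
  nonneg : ∀ a b, 0 ≤ d a b
  /-- the triangle inequality -/
  triangle : ∀ a b c, d a c ≤ d a b + d b c

/-- The **diameter** of a finite label set for the pseudo-distance `d` (zero for the empty set). [folklore] -/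
def labelDiam (d : Λ → Λ → ℝ) (S : Finset Λ) : ℝ :=
  ((S ×ˢ S).sup fun p : Λ × Λ => (d p.1 p.2).toNNReal : NNReal)

/-- Diameters are nonnegative. [folklore] -/
theorem labelDiam_nonneg (d : Λ → Λ → ℝ) (S : Finset Λ) : 0 ≤ labelDiam d S := NNReal.coe_nonneg _

/-- Distances within a set are bounded by its diameter. [folklore] -/
theorem le_labelDiam (d : Λ → Λ → ℝ) {S : Finset Λ} {a b : Λ} (ha : a ∈ S) (hb : b ∈ S) : d a b ≤ labelDiam d S := by
  have h : (d a b).toNNReal ≤ (S ×ˢ S).sup fun p : Λ × Λ => (d p.1 p.2).toNNReal :=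
    Finset.le_sup (f := fun p : Λ × Λ => (d p.1 p.2).toNNReal) (b := (a, b)) (mem_product.2 ⟨ha, hb⟩)
  exact (Real.le_coe_toNNReal (d a b)).trans (NNReal.coe_le_coe.2 h)

/-- A bound for all the distances within a set bounds its diameter. [folklore] -/
theorem labelDiam_le (d : Λ → Λ → ℝ) {S : Finset Λ} {r : ℝ} (hr : 0 ≤ r) (h : ∀ a ∈ S, ∀ b ∈ S, d a b ≤ r) :
    labelDiam d S ≤ r := by
  have hsup : ((S ×ˢ S).sup fun p : Λ × Λ => (d p.1 p.2).toNNReal) ≤ r.toNNReal :=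
    Finset.sup_le fun p hp => Real.toNNReal_le_toNNReal (h p.1 (mem_product.1 hp).1 p.2 (mem_product.1 hp).2)
  calc labelDiam d S ≤ ((r.toNNReal : NNReal) : ℝ) := NNReal.coe_le_coe.2 hsup
    _ = r := Real.coe_toNNReal r hr

/-- The diameter is monotone under inclusion. [folklore] -/
theorem labelDiam_mono (d : Λ → Λ → ℝ) {S T : Finset Λ} (hST : S ⊆ T) : labelDiam d S ≤ labelDiam d T :=
  labelDiam_le d (labelDiam_nonneg d T) fun _ ha _ hb => le_labelDiam d (hST ha) (hST hb)

/-- **The diameter of an overlapping union** is at most the sum of the diameters. [folklore] -/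
theorem labelDiam_union_le [DecidableEq Λ] {d : Λ → Λ → ℝ} (hd : IsLabelDist d) {S T : Finset Λ} (hST : (S ∩ T).Nonempty) :
    labelDiam d (S ∪ T) ≤ labelDiam d S + labelDiam d T := by
  obtain ⟨c, hc⟩ := hST
  obtain ⟨hcS, hcT⟩ := mem_inter.1 hc
  have hS := labelDiam_nonneg d S
  have hT := labelDiam_nonneg d T
  refine labelDiam_le d (add_nonneg hS hT) fun a ha b hb => ?_
  rcases mem_union.1 ha with haS | haT <;> rcases mem_union.1 hb with hbS | hbT
  · exact (le_labelDiam d haS hbS).trans (le_add_of_nonneg_right hT)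
  · exact (hd.triangle a c b).trans (add_le_add (le_labelDiam d haS hcS) (le_labelDiam d hcT hbT))
  · calc d a b ≤ d a c + d c b := hd.triangle a c b
      _ ≤ labelDiam d T + labelDiam d S := add_le_add (le_labelDiam d haT hcT) (le_labelDiam d hcS hbS)
      _ = labelDiam d S + labelDiam d T := add_comm _ _
  · exact (le_labelDiam d haT hbT).trans (le_add_of_nonneg_left hS)

/-- The diameter of a pair is the distance. [folklore] -/
theorem labelDiam_pair [DecidableEq Λ] {d : Λ → Λ → ℝ} (hd : IsLabelDist d) (a b : Λ) : labelDiam d {a, b} = d a b := by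
  refine le_antisymm (labelDiam_le d (hd.nonneg a b) fun a' ha' b' hb' => ?_) (le_labelDiam d (by simp) (by simp))
  simp only [mem_insert, mem_singleton] at ha' hb'
  rcases ha' with rfl | rfl <;> rcases hb' with rfl | rfl
  · rw [hd.self]; exact hd.nonneg _ _
  · exact le_rfl
  · rw [hd.symm]
  · rw [hd.self]; exact hd.nonneg _ _

/-- The diameter of a singleton vanishes. [folklore] -/
theorem labelDiam_singleton [DecidableEq Λ] {d : Λ → Λ → ℝ} (hd : IsLabelDist d) (a : Λ) : labelDiam d {a} = 0 := by
  rw [← pair_eq_singleton, labelDiam_pair hd, hd.self]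

/-- The **diameter weight** `wt S = φ (diam S)`. [folklore] -/
def diamWeight (φ : ℝ → ℝ) (d : Λ → Λ → ℝ) (S : Finset Λ) : ℝ := φ (labelDiam d S)

/-- **Diameter weights are tree weights** for `φ ≥ 1` monotone and submultiplicative on `[0, ∞)`. [folklore] -/
theorem isTreeWeight_diamWeight [DecidableEq Λ] {φ : ℝ → ℝ} {d : Λ → Λ → ℝ} (hd : IsLabelDist d) (h1 : ∀ s, 0 ≤ s → 1 ≤ φ s)
    (hmono : ∀ s t, 0 ≤ s → s ≤ t → φ s ≤ φ t) (hsub : ∀ s t, 0 ≤ s → 0 ≤ t → φ (s + t) ≤ φ s * φ t) :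
    IsTreeWeight (diamWeight φ d) where
  one_le S := h1 _ (labelDiam_nonneg d S)
  mono S _ hST := hmono _ _ (labelDiam_nonneg d S) (labelDiam_mono d hST)
  union_le S T hST :=
    (hmono _ _ (labelDiam_nonneg d _) (labelDiam_union_le hd hST)).trans
      (hsub _ _ (labelDiam_nonneg d S) (labelDiam_nonneg d T))

/-- The diameter weight of a pair. [folklore] -/
theorem diamWeight_pair [DecidableEq Λ] {φ : ℝ → ℝ} {d : Λ → Λ → ℝ} (hd : IsLabelDist d) (a b : Λ) : diamWeight φ d {a, b} = φ (d a b) := by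
  rw [diamWeight, labelDiam_pair hd]

/-- **The polynomial diameter weight `(1 + c · diam S)^N` is a tree weight** (`c ≥ 0`). [folklore] -/
theorem isTreeWeight_polyDiamWeight [DecidableEq Λ] {d : Λ → Λ → ℝ} (hd : IsLabelDist d) {c : ℝ} (hc : 0 ≤ c) (N : ℕ) :
    IsTreeWeight (diamWeight (fun s => (1 + c * s) ^ N) d) := by
  refine isTreeWeight_diamWeight hd (fun s hs => one_le_pow₀ (by nlinarith)) (fun s t hs hst => ?_) (fun s t hs ht => ?_)
  · exact pow_le_pow_left₀ (by nlinarith) (by nlinarith) N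
  · rw [← mul_pow]
    exact pow_le_pow_left₀ (by nlinarith) (by nlinarith [mul_nonneg (mul_nonneg hc hs) (mul_nonneg hc ht)]) N

/-- **The polynomial pair weight dominates the moments**: `(c · d(a,b))^j ≤ (1 + c · d(a,b))^N` for `j ≤ N`.
[folklore] -/
theorem pow_le_polyDiamWeight_pair [DecidableEq Λ] {d : Λ → Λ → ℝ} (hd : IsLabelDist d) {c : ℝ} (hc : 0 ≤ c) {N j : ℕ} (hj : j ≤ N)
    (a b : Λ) : (c * d a b) ^ j ≤ diamWeight (fun s => (1 + c * s) ^ N) d {a, b} := by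
  rw [diamWeight_pair hd]
  have h0 : 0 ≤ c * d a b := mul_nonneg hc (hd.nonneg a b)
  calc (c * d a b) ^ j ≤ (1 + c * d a b) ^ j := pow_le_pow_left₀ h0 (by linarith) j
    _ ≤ (1 + c * d a b) ^ N := pow_le_pow_right₀ (by linarith) hj

/-- **The exponential diameter weight `e^{c · diam S}` is a tree weight** (`c ≥ 0`). [folklore] -/
theorem isTreeWeight_expDiamWeight [DecidableEq Λ] {d : Λ → Λ → ℝ} (hd : IsLabelDist d) {c : ℝ} (hc : 0 ≤ c) :
    IsTreeWeight (diamWeight (fun s => Real.exp (c * s)) d) := by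
  refine isTreeWeight_diamWeight hd (fun s hs => Real.one_le_exp (mul_nonneg hc hs))
    (fun s t _ hst => Real.exp_le_exp.2 (mul_le_mul_of_nonneg_left hst hc)) (fun s t _ _ => ?_)
  rw [mul_add, Real.exp_add]

end Diam

/-! ### The tree product bound -/

section TreeProduct

variable {Λ : Type*} [DecidableEq Λ] {wt : Finset Λ → ℝ}
variable {ι : Type*} [DecidableEq ι] {v : ι} {S : Type*} [Fintype S] [DecidableEq S]

/-- **The tree product bound for a tree weight** (the decay bookkeeping of Benfatto–Giuliani–Mastropietro 2006,
§3 and Gentile–Mastropietro 2001, §4): for a valid script `s` rooted at `v`, slots `τ : S` at the points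
`cS τ` carrying the labels `x τ`, and, for every line `ℓ` of `s`, a pair of slots `e ℓ` at the two points of `ℓ`,
the weight of the set of all the labels of the points of `s` is at most the product of the weights of the label
sets of the single points times the product over the lines of the pair weights `wt {x (e ℓ).1, x (e ℓ).2}`.
[cite: BenfattoGiulianiMastropietro2006, §3 (3.2)-(3.8)] -/
theorem IsTreeWeight.wt_image_le_prod (hwt : IsTreeWeight wt) (cS : S → ι) (x : S → Λ) (e : Sym2 ι → S × S) :
    ∀ {k : ℕ} (s : Script v k), s.Valid → (∀ ℓ ∈ s.lines, s(cS (e ℓ).1, cS (e ℓ).2) = ℓ) →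
      wt ((univ.filter fun τ => cS τ ∈ univ.image s.y).image x) ≤
        (∏ u ∈ univ.image s.y, wt ((univ.filter fun τ => cS τ = u).image x)) *
          (s.lines.map fun ℓ => wt {x (e ℓ).1, x (e ℓ).2}).prod
  | _, Script.nil, _, _ => by
    rw [Script.image_y_nil, prod_singleton]
    simp only [mem_singleton, Script.lines, List.map_nil, List.prod_nil, mul_one]
    exact le_rfl
  | k + 1, Script.snoc s i z, hv, he => by
    obtain ⟨hs, hz⟩ := hv
    set Q := (univ : Finset (Fin (k + 1))).image s.y with hQ
    have hzQ : z ∉ Q := fun h => by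
      obtain ⟨m, -, hm⟩ := mem_image.1 h; exact hz m hm
    have hyQ : s.y i ∈ Q := mem_image.2 ⟨i, mem_univ _, rfl⟩
    have hlines : (Script.snoc s i z).lines = s.lines ++ [s(s.y i, z)] := rfl
    -- the induction hypothesis
    have ih := IsTreeWeight.wt_image_le_prod hwt cS x e s hs fun ℓ hℓ => he ℓ (by rw [hlines]; exact List.mem_append_left _ hℓ)
    -- the new line and its slots
    obtain he₀ := he s(s.y i, z) (by rw [hlines]; simp)
    set A := (univ.filter fun τ => cS τ ∈ Q).image x with hA
    set B := (univ.filter fun τ => cS τ = z).image x with hB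
    have hsplit : (univ.filter fun τ => cS τ ∈ (univ : Finset (Fin (k + 2))).image (Script.snoc s i z).y).image x = A ∪ B := by
      rw [Script.image_y_snoc, ← image_union, ← filter_or]
      congr 1
      exact filter_congr fun τ _ => by rw [mem_insert, or_comm]
    -- one slot of the new line is at a point of `Q`, the other at `z`
    have hpair : ∃ a ∈ A, ∃ b ∈ B, ({x (e s(s.y i, z)).1, x (e s(s.y i, z)).2} : Finset Λ) = {a, b} := by
      rcases Sym2.eq_iff.1 he₀ with ⟨h1, h2⟩ | ⟨h1, h2⟩
      · exact ⟨x (e s(s.y i, z)).1, mem_image.2 ⟨_, mem_filter.2 ⟨mem_univ _, by rw [h1]; exact hyQ⟩, rfl⟩,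
          x (e s(s.y i, z)).2, mem_image.2 ⟨_, mem_filter.2 ⟨mem_univ _, h2⟩, rfl⟩, rfl⟩
      · exact ⟨x (e s(s.y i, z)).2, mem_image.2 ⟨_, mem_filter.2 ⟨mem_univ _, by rw [h2]; exact hyQ⟩, rfl⟩,
          x (e s(s.y i, z)).1, mem_image.2 ⟨_, mem_filter.2 ⟨mem_univ _, h1⟩, rfl⟩, pair_comm _ _⟩
    obtain ⟨a, ha, b, hb, hab⟩ := hpair
    -- assemble
    have hP0 : 0 ≤ ∏ u ∈ Q, wt ((univ.filter fun τ => cS τ = u).image x) := prod_nonneg fun u _ => hwt.nonneg _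
    have hL0 : 0 ≤ (s.lines.map fun ℓ => wt {x (e ℓ).1, x (e ℓ).2}).prod := hwt.prod_map_nonneg s.lines _
    rw [hsplit, Script.image_y_snoc, prod_insert hzQ, hlines, List.map_append, List.prod_append, List.map_singleton,
      List.prod_singleton, hab]
    calc wt (A ∪ B) ≤ wt A * wt {a, b} * wt B := hwt.union_le_of_mem ha hb
      _ ≤ ((∏ u ∈ Q, wt ((univ.filter fun τ => cS τ = u).image x)) * (s.lines.map fun ℓ => wt {x (e ℓ).1, x (e ℓ).2}).prod) *
            wt {a, b} * wt B :=
          mul_le_mul_of_nonneg_right (mul_le_mul_of_nonneg_right ih (hwt.nonneg _)) (hwt.nonneg _)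
      _ = wt B * (∏ u ∈ Q, wt ((univ.filter fun τ => cS τ = u).image x)) *
            ((s.lines.map fun ℓ => wt {x (e ℓ).1, x (e ℓ).2}).prod * wt {a, b}) := by ring

end TreeProduct

end BattleFederbush

end Literature.Probability.LatticeModels
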